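import Literature.MathematicalPhysics.QuantumFieldTheory.Balaban1983to89.B14DomainGeom

/-!
# `Balaban1983to89.B14Eq21Layer` — CMP 119 p. 255: *"If Ω_j ∩ Λ_jᶜ is nonempty, then S_j is nonempty too; in fact it
# contains Ω_j ∖ Ω_j^{∼−1}"* — the boundary layer `Ω ∖ Ω^{∼−1}` of a non-empty domain with non-empty complement is
# NON-EMPTY (lattice connectivity of ℤᵈ), so `S_j ≠ ∅` follows from the (2.1) clauses alone; PROVED

statement-level skeleton of published theorems with citation tags; proofs where landed; nothing here is a claim about the Yang–Mills mass gap

CITATION HEADER (lean-in-tree rule).  Source: T. Bałaban, *Convergent renormalization expansions for lattice gauge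
theories*, Commun. Math. Phys. **119**, 243–285 (1988), doi:10.1007/bf01217741 [Balaban1988Convergent] (cell paper
B14 = «[III]»; p. 255 = PDF 13, render `…-p013-x2.png`).  Mega-formalization `lit-balaban`, unit `lit-balaban-r11` (B14
fold owner), SKELETON row **B14.Eq2.1** (member `B14Eq21Admissible`, p368721, whose `Adm21.S_nonempty` takes the non-emptiness
of the layer as a hypothesis; here that hypothesis is PROVED on pv02's carrier `B14DomainGeom`).

THE PRINTED TEXT (p. 255, verbatim).  *"If Ω_j ∩ Λ_jᶜ is nonempty, then S_j is nonempty too; in fact it contains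
Ω_j ∖ Ω_j^{∼−1} = Ω_j ∩ (Ω_jᶜ)^∼."*  Print takes for granted that the layer `Ω_j ∖ Ω_j^{∼−1}` of a localization domain is
non-empty; on the cube carrier this is the connectivity of the lattice: walking along lattice bonds from a point of `Ω`
to a point outside `Ω` one meets a point of `Ω` with a neighbour — hence a neighbouring cube — outside `Ω`.

WHAT IS PROVED (0 `sorry`; theorems only).  `layer_nonempty` — for `s ≥ 1`, `x ∈ Ω`, `y ∉ Ω`: `(Ω ∖ innerN s 1 Ω).Nonempty`
(induction on the ℓ¹-distance `Σ_i |x_i − y_i|`, one unit bond at a time; a unit bond is an `IdxNear s 1` step by pv02's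
`idxNear_of_within`); `nonempty_of_layer_subset` — *"then S_j is nonempty too"* for any `S_j ⊇ Ω_j ∖ Ω_j^{∼−1}` (the (2.1)
clause `B14.Eq21Admissible.Adm21.S_layer`; feed `Adm21.S_nonempty` with `layer_nonempty_of_ne_univ`), given only that
`Ω_j` is not the whole lattice.  Imports `B14DomainGeom` only (the `Adm21` file is not needed for the lemma).

## References
* [Balaban1988Convergent] T. Bałaban, Commun. Math. Phys. 119 (1988) 243–285, §2 p. 255.
-/

namespace Literature.MathematicalPhysics.QuantumFieldTheory.Balaban1983to89.B14.Eq21Layer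

open Literature.MathematicalPhysics.QuantumFieldTheory.Balaban1983to89
open B14DomainGeom Finset

variable {d : ℕ}

/-- One unit lattice bond is a step between equal or adjacent side-`s` cubes (`s ≥ 1`). [cite: Balaban1988Convergent, §2 p.255] -/
theorem idxNear_update_unit {s : ℕ} (hs : 0 < s) (x : Pt d) (i : Fin d) (e : ℤ) (he : |e| ≤ 1) :
    IdxNear s 1 x (Function.update x i (x i + e)) := by
  refine idxNear_of_within s 1 hs (fun j => ?_)
  have hs1 : (1 : ℤ) ≤ (1 : ℕ) * (s : ℤ) := by
    have : (1 : ℤ) ≤ s := by exact_mod_cast hs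
    simpa using this
  by_cases hj : j = i
  · subst hj
    simp only [Function.update_self, sub_add_cancel_left, abs_neg]
    exact he.trans hs1
  · rw [Function.update_of_ne hj]
    simp only [sub_self, abs_zero]
    exact le_trans (by norm_num) hs1

/-- **The boundary layer is non-empty** (p. 255, used for *"then S_j is nonempty too"*): if `x ∈ Ω` and `y ∉ Ω` then some
point of `Ω` has a side-`s` index-neighbour outside `Ω`, i.e. `Ω ∖ Ω^{∼−1} ≠ ∅` (`s ≥ 1`). [cite: Balaban1988Convergent, §2 p.255] -/
theorem layer_nonempty {s : ℕ} (hs : 0 < s) {Ω : Set (Pt d)} {x y : Pt d} (hx : x ∈ Ω) (hy : y ∉ Ω) :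
    (Ω \ innerN s 1 Ω).Nonempty := by
  suffices H : ∀ (n : ℕ) (x : Pt d), ∑ i, (x i - y i).natAbs = n → x ∈ Ω → (Ω \ innerN s 1 Ω).Nonempty from
    H _ x rfl hx
  intro n
  induction n using Nat.strong_induction_on with
  | _ n ih =>
    intro x hn hx
    by_cases hxy : x = y
    · exact absurd (hxy ▸ hx) hy
    obtain ⟨i, hi⟩ : ∃ i, x i ≠ y i := by
      by_contra h
      push Not at h
      exact hxy (funext h)
    -- one unit step in direction `i` towards `y`
    set e : ℤ := if x i < y i then 1 else -1 with he_def
    have he : |e| ≤ 1 := by rw [he_def]; split_ifs <;> simp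
    set x' : Pt d := Function.update x i (x i + e) with hx'_def
    have hnear : IdxNear s 1 x x' := idxNear_update_unit hs x i e he
    by_cases hx' : x' ∈ Ω
    · -- the distance to `y` strictly decreases; recurse
      have hdec : (x' i - y i).natAbs + 1 = (x i - y i).natAbs := by
        have hx'i : x' i = x i + e := by rw [hx'_def, Function.update_self]
        rw [hx'i, he_def]
        split_ifs with hlt <;> omega
      have hlt : ∑ j, (x' j - y j).natAbs < n := by
        have hsplit := Finset.add_sum_erase (Finset.univ) (fun j => (x j - y j).natAbs) (Finset.mem_univ i)
        have hsplit' := Finset.add_sum_erase (Finset.univ) (fun j => (x' j - y j).natAbs) (Finset.mem_univ i)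
        have hrest : ∑ j ∈ Finset.univ.erase i, (x' j - y j).natAbs = ∑ j ∈ Finset.univ.erase i, (x j - y j).natAbs := by
          apply Finset.sum_congr rfl
          intro j hj
          rw [hx'_def, Function.update_of_ne (Finset.ne_of_mem_erase hj)]
        rw [← hn, ← hsplit, ← hsplit', hrest]
        omega
      exact ih _ hlt x' rfl hx'
    · exact ⟨x, hx, fun hin => hx' (hin.2 x' hnear)⟩

/-- A non-empty domain which is not the whole lattice has a non-empty boundary layer. [cite: Balaban1988Convergent, §2 p.255] -/
theorem layer_nonempty_of_ne_univ {s : ℕ} (hs : 0 < s) {Ω : Set (Pt d)} (hΩ : Ω.Nonempty) (hΩc : Ωᶜ.Nonempty) :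
    (Ω \ innerN s 1 Ω).Nonempty := by
  obtain ⟨x, hx⟩ := hΩ
  obtain ⟨y, hy⟩ := hΩc
  exact layer_nonempty hs hx hy

/-- **p. 255: *"If Ω_j ∩ Λ_jᶜ is nonempty, then S_j is nonempty too; in fact it contains Ω_j ∖ Ω_j^{∼−1}"*** — at the
carrier level: any `S ⊇ Ω ∖ Ω^{∼−1}` (the (2.1) clause `B14.Eq21Admissible.Adm21.S_layer`) is non-empty as soon as `Ω` is
non-empty and not the whole lattice (feed `B14.Eq21Admissible.Adm21.S_nonempty` with `layer_nonempty_of_ne_univ`).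
[cite: Balaban1988Convergent, (2.1) pp.254–255] -/
theorem nonempty_of_layer_subset {s : ℕ} (hs : 0 < s) {Ω S : Set (Pt d)} (hS : Ω \ innerN s 1 Ω ⊆ S)
    (hΩ : Ω.Nonempty) (hΩc : Ωᶜ.Nonempty) : S.Nonempty :=
  (layer_nonempty_of_ne_univ hs hΩ hΩc).mono hS

end Literature.MathematicalPhysics.QuantumFieldTheory.Balaban1983to89.B14.Eq21Layer
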